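/-
Copyright: the b2b-balaban cell (near-miss cell 7), T⁴-continuum fan-out; row NE7b ROUND-2 swarm, seat
t4-ne7b-formalise-leaf-05 gen 3 (row S6g′ INSTANCE of `t4/b2b-balaban-t4-ne7b-p1/LEAVES-NE7b.md`, owner's ruling
R-OWNER-22-23: T3a; finding F-leaf05g3-2).  Released under the licence of the surrounding project.
-/
import Summits.QuantumFields.BalabanUV.T4Continuum.Support.HistoryJoinsSupEnd

/-!
# Placements that CARRY the births' region templates: the root datum `(cell, template)`, its nearness relation,
# witness radius, one-block count and exponential type (row S6g′ INSTANCE, T3a — part 1 «PLACED», F-leaf05g3-2 (3))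

Summits-side support leaf of the T⁴-continuum cell (rung (B)+1 on a FINITE torus only; NOT infinite volume, NOT the
mass gap, NOT the Clay statement; NOT a proof of the spine estimate NE7b).  Row NE7b, route «COUNT», row S6g′.
[folklore] finite bookkeeping over the lineage's own carriers (gen 2's count `HistoryJoins*`, leaf-02 gen 4's torus
currency `HistoryJoinsSupTorus`); nothing is quoted from print, nothing printed is asserted, no `[cite:]` tag, no
`Prop` fact minted (`nearP` is a RELATION with parameters, like `HistoryJoinsSup.nearOfNat`).  The template type is
ABSTRACT here (`Tm` with a size `tsz` and a displayed count `A m` of the templates of size `≤ m`, of exponential type)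
— leaf-10 gen 4's `HistoryRegionTemplates`∕`HistoryJoinsTemplates` instantiate it with the face-connected templates of
`ℤ^d` and the lattice-animal count.

WHY (F-leaf05g3-2).  The count's zone of a sub-structure under a placement must be a FUNCTION of the placement and must
contain the realised region of every birth (else realised contact does not certify the count's contact forest), with
LINEAR mass; so the placement value of a birth is its anchor cell AND its region template: `γ′ = TCell d (n·L^K) × Tm`.
The one-block ROOT COUNT `hNZ` of gen 2's count is blind to the root's label; it stays uniform because the template
SIZE is tied to the RADIUS: the nearness relation asks `tsz T ≤ r + 1`, the witness radius is
`max (cyclic sup-distance) (tsz T − 1)`, and the count of root data near a block is `NZD · A(⌊r⌋₊ + 1)` — still of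
exponential type in `r` when `A m ≤ exp(a₁ + d₁·m)`.  The price (a non-decaying potential `fat (root P) + 1` in the
extent law at the NON-HOST parts) is paid in part 2 (`HistoryJoinsPlacedEnd`, with `HistoryJoinsNonhost`).

WHAT.  §1 `nearP`, `radP` (the witness radius), `nearP_mono`, **`nearP_of_scale`** (the END's reading fact `hnearW`),
`le_floor_add_one_of_le`.  §2 `NZP' A`, **`card_nearP_le`** (the END's `hNZ`: `≤ NZD d L lv r t s · A (⌊r⌋₊ + 1)`),
`MρP' A`, `MρP'_nonneg`, **`NZP'_le`** (the END's `hNZle`, `Λ := L^d`), **`MρP'_le_exp`** (exponential type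
`exp((a₁ + d₁) + (2d + d₁)·r)`).  §3 sanity.

HONEST SCOPE.  Bookkeeping over OUR carriers; displays: the template count `hA`, its exponential type; nothing of
H3∕(B)∕BetaPertH touched; `BirthShapeNodup` NOT retired here; NE7b NOT proved.  HONEST DEPENDENCY (cell): continuum YM
on T⁴ ⇐ BetaPertH ∧ nine spine estimates (0/9 proved); BetaPertH ⇐ (D1) ∧ (D4) ∧ CAP+tail; G-an2-4 gates asym, D1 and
NE2/3/4.  This file changes none of it.
-/

open Finset
open Summit.QuantumFields.BalabanUV.T4Continuum.ZoneTorus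
open Summit.QuantumFields.BalabanUV.T4Continuum.HistoryMassPlacement
open Summit.QuantumFields.BalabanUV.T4Continuum.HistoryJoinsSup
open Summit.QuantumFields.BalabanUV.T4Continuum.HistoryJoinsSupTorus

namespace Summit.QuantumFields.BalabanUV.T4Continuum.HistoryJoinsPlaced

noncomputable section

open scoped Classical

/-- a natural size `≤ r + 1` is at most `⌊r⌋₊ + 1` [folklore] -/
theorem le_floor_add_one_of_le {k : ℕ} {r : ℝ} (h : (k : ℝ) ≤ r + 1) : k ≤ ⌊r⌋₊ + 1 := by
  by_contra hk
  rw [not_le] at hk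
  have h1 : (⌊r⌋₊ : ℝ) + 2 ≤ k := by exact_mod_cast hk
  have h2 : r < (⌊r⌋₊ : ℝ) + 1 := Nat.lt_floor_add_one r
  linarith

/-! ## §1 The nearness relation and the witness radius of a root datum `(cell, template)` -/

section Near

variable {d : ℕ} (n L K : ℕ) (lv : ℕ → ℕ) {Tm : Type*} (tsz : Tm → ℕ)

/-- **NEARNESS OF A ROOT DATUM**: the cell is near the block at levels (leaf-02 gen 4's `nearD`) AND the template is
small against the radius, `tsz T ≤ r + 1`. [folklore] -/
def nearP : (Fin d → ℕ) → ℕ → TCell d (n * L ^ K) × Tm → ℕ → ℝ → Prop := fun u t yT s r =>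
  nearD n L K lv u t yT.1 s r ∧ (tsz yT.2 : ℝ) ≤ r + 1

/-- **THE WITNESS RADIUS** of a block against a root datum: the cyclic sup-distance to the cell's level-`lv t` block,
or the template's excess size, whichever is larger. [folklore] -/
def radP : (Fin d → ℕ) → ℕ → TCell d (n * L ^ K) × Tm → ℕ → ℝ := fun u t yT _ =>
  max ((cdist (n * L ^ (K - lv t)) u (blk L (lv t) yT.1) : ℕ) : ℝ) ((tsz yT.2 : ℝ) - 1)

/-- unfolding `nearP` [folklore] -/
theorem nearP_iff (u : Fin d → ℕ) (t : ℕ) (yT : TCell d (n * L ^ K) × Tm) (s : ℕ) (r : ℝ) :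
    nearP n L K lv tsz u t yT s r ↔ nearD n L K lv u t yT.1 s r ∧ (tsz yT.2 : ℝ) ≤ r + 1 := Iff.rfl

/-- unfolding `radP` [folklore] -/
theorem radP_apply (u : Fin d → ℕ) (t : ℕ) (yT : TCell d (n * L ^ K) × Tm) (s : ℕ) :
    radP n L K lv tsz u t yT s =
      max ((cdist (n * L ^ (K - lv t)) u (blk L (lv t) yT.1) : ℕ) : ℝ) ((tsz yT.2 : ℝ) - 1) := rfl

/-- `nearP` is monotone in the radius (the END's `hmono`) [folklore] -/
theorem nearP_mono (u : Fin d → ℕ) (t : ℕ) (yT : TCell d (n * L ^ K) × Tm) (s : ℕ) (r r' : ℝ)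
    (h : nearP n L K lv tsz u t yT s r) (hr : r ≤ r') : nearP n L K lv tsz u t yT s r' :=
  ⟨nearD_mono n L K lv u t yT.1 s r r' h.1 hr, h.2.trans (by linarith)⟩

/-- **THE READING FACT `hnearW`**: a block in range at level `lv t ≤ K` is near a root datum whose cell has scale `lv s`
at the witness radius `radP`. [folklore] -/
theorem nearP_of_scale {t s : ℕ} {u : Fin d → ℕ} {yT : TCell d (n * L ^ K) × Tm} (htK : lv t ≤ K)
    (hy : IsScale L (lv s) yT.1) (hu : ∀ i, u i < n * L ^ (K - lv t)) :
    nearP n L K lv tsz u t yT s (radP n L K lv tsz u t yT s) := by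
  refine ⟨nearD_mono n L K lv u t yT.1 s _ _ (nearD_of_scale htK hy hu) (le_max_left _ _), ?_⟩
  have := le_max_right ((cdist (n * L ^ (K - lv t)) u (blk L (lv t) yT.1) : ℕ) : ℝ) ((tsz yT.2 : ℝ) - 1)
  show (tsz yT.2 : ℝ) ≤ radP n L K lv tsz u t yT s + 1
  rw [radP_apply]
  linarith

/-- the witness radius is nonnegative [folklore] -/
theorem radP_nonneg (u : Fin d → ℕ) (t : ℕ) (yT : TCell d (n * L ^ K) × Tm) (s : ℕ) :
    0 ≤ radP n L K lv tsz u t yT s :=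
  le_trans (Nat.cast_nonneg _) (le_max_left _ _)

/-- the cyclic distance is below the witness radius [folklore] -/
theorem cdist_le_radP (u : Fin d → ℕ) (t : ℕ) (yT : TCell d (n * L ^ K) × Tm) (s : ℕ) :
    ((cdist (n * L ^ (K - lv t)) u (blk L (lv t) yT.1) : ℕ) : ℝ) ≤ radP n L K lv tsz u t yT s := le_max_left _ _

/-- the template's excess size is below the witness radius [folklore] -/
theorem tsz_le_radP (u : Fin d → ℕ) (t : ℕ) (yT : TCell d (n * L ^ K) × Tm) (s : ℕ) :
    (tsz yT.2 : ℝ) - 1 ≤ radP n L K lv tsz u t yT s := le_max_right _ _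

/-- **`hNZ` FOR ROOT DATA**: `#{(y, T) | nearP u t (y, T) s r} ≤ NZD d L lv r t s · A (⌊r⌋₊ + 1)`, given the template
count `#{T | tsz T ≤ m} ≤ A m`. [folklore] -/
theorem card_nearP_le [Fintype Tm] (hL : 1 ≤ L) {A : ℕ → ℕ}
    (hA : ∀ m : ℕ, ((univ : Finset Tm).filter fun T => tsz T ≤ m).card ≤ A m)
    (u : Fin d → ℕ) (t s : ℕ) (r : ℝ) :
    ((univ : Finset (TCell d (n * L ^ K) × Tm)).filter fun yT => nearP n L K lv tsz u t yT s r).card ≤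
      NZD d L lv r t s * A (⌊r⌋₊ + 1) := by
  have hsub : ((univ : Finset (TCell d (n * L ^ K) × Tm)).filter fun yT => nearP n L K lv tsz u t yT s r) ⊆
      ((univ : Finset (TCell d (n * L ^ K))).filter fun y => nearD n L K lv u t y s r) ×ˢ
        ((univ : Finset Tm).filter fun T => tsz T ≤ ⌊r⌋₊ + 1) := by
    intro yT h
    rw [mem_filter] at h
    rw [mem_product, mem_filter, mem_filter]
    exact ⟨⟨mem_univ _, h.2.1⟩, ⟨mem_univ _, le_floor_add_one_of_le h.2.2⟩⟩
  refine (card_le_card hsub).trans ?_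
  rw [card_product]
  exact Nat.mul_le_mul (card_nearD_le n hL K lv u t s r) (hA _)

end Near

/-! ## §2 The one-block count of root data and its exponential type -/

section Count

variable (d L : ℕ) (lv : ℕ → ℕ)

/-- **THE ONE-BLOCK ROOT-DATUM COUNT**: cells near the block (leaf-02 gen 4's `NZD`) times templates of size
`≤ ⌊r⌋₊ + 1`. [folklore] -/
def NZP' (A : ℕ → ℕ) (r : ℝ) (t s : ℕ) : ℕ := NZD d L lv r t s * A (⌊r⌋₊ + 1)

/-- **THE RADIUS FACTOR OF ROOT DATA**: `MρT d r · A (⌊r⌋₊ + 1)`. [folklore] -/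
def MρP' (A : ℕ → ℕ) (r : ℝ) : ℝ := MρT d r * (A (⌊r⌋₊ + 1) : ℝ)

variable {d L lv}

/-- unfolding `NZP'` [folklore] -/
theorem NZP'_apply (A : ℕ → ℕ) (r : ℝ) (t s : ℕ) : NZP' d L lv A r t s = NZD d L lv r t s * A (⌊r⌋₊ + 1) := rfl

/-- the radius factor is nonnegative [folklore] -/
theorem MρP'_nonneg (A : ℕ → ℕ) (r : ℝ) : 0 ≤ MρP' d A r := mul_nonneg (MρT_nonneg d r) (Nat.cast_nonneg _)

/-- **`hNZle` FOR ROOT DATA**: `NZP' ≤ MρP' · (L^d)^{t+1−s}` under a level function. [folklore] -/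
theorem NZP'_le {K : ℕ} (hlv : HistoryZones.LevelFn K lv) (hL : 1 ≤ L) (A : ℕ → ℕ) (r : ℝ) (t s : ℕ) :
    (NZP' d L lv A r t s : ℝ) ≤ MρP' d A r * ((L : ℝ) ^ d) ^ (t + 1 - s) := by
  unfold NZP' MρP'
  push_cast
  have h1 := NZD_le hlv hL d r t s
  have hA : (0 : ℝ) ≤ A (⌊r⌋₊ + 1) := Nat.cast_nonneg _
  calc (NZD d L lv r t s : ℝ) * (A (⌊r⌋₊ + 1) : ℝ) ≤ MρT d r * ((L : ℝ) ^ d) ^ (t + 1 - s) * A (⌊r⌋₊ + 1) :=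
        mul_le_mul_of_nonneg_right h1 hA
    _ = MρT d r * (A (⌊r⌋₊ + 1) : ℝ) * ((L : ℝ) ^ d) ^ (t + 1 - s) := by ring

/-- **THE EXPONENTIAL TYPE SURVIVES**: if the template count is exponential in the size, `A m ≤ exp(a₁ + d₁·m)`
(`d₁ ≥ 0`), then `MρP' d A r ≤ exp((a₁ + d₁) + (2d + d₁)·r)` for `r ≥ 0`. [folklore] -/
theorem MρP'_le_exp {A : ℕ → ℕ} {a₁ d₁ : ℝ} (hd : 0 ≤ d₁) (hAexp : ∀ m : ℕ, (A m : ℝ) ≤ Real.exp (a₁ + d₁ * m))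
    {r : ℝ} (hr : 0 ≤ r) : MρP' d A r ≤ Real.exp ((a₁ + d₁) + (2 * (d : ℝ) + d₁) * r) := by
  unfold MρP'
  have h1 := MρT_le_exp d hr
  have h2 := hAexp (⌊r⌋₊ + 1)
  have hfl : ((⌊r⌋₊ + 1 : ℕ) : ℝ) ≤ r + 1 := by push_cast; linarith [Nat.floor_le hr]
  have h3 : Real.exp (a₁ + d₁ * ((⌊r⌋₊ + 1 : ℕ) : ℝ)) ≤ Real.exp (a₁ + d₁ * (r + 1)) :=
    Real.exp_le_exp.2 (by nlinarith)
  calc MρT d r * (A (⌊r⌋₊ + 1) : ℝ) ≤ Real.exp (0 + 2 * (d : ℝ) * r) * Real.exp (a₁ + d₁ * (r + 1)) :=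
        mul_le_mul h1 (h2.trans h3) (Nat.cast_nonneg _) (Real.exp_pos _).le
    _ = Real.exp ((a₁ + d₁) + (2 * (d : ℝ) + d₁) * r) := by rw [← Real.exp_add]; ring_nf

end Count

/-! ## §3 Sanity (decided) -/

namespace Sanity

/-- with a one-template type every root datum carries the template, and the nearness clause `tsz ≤ r + 1` with
`tsz = 1` holds at every nonnegative radius -/
example (u : Fin 1 → ℕ) (y : TCell 1 (1 * 2 ^ 3)) (h : nearD 1 2 3 id u 0 y 0 (0 : ℝ)) :
    nearP 1 2 3 id (fun _ : Unit => 1) u 0 (y, ()) 0 0 := ⟨h, by norm_num⟩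

/-- the one-block count with the constant template count `A ≡ 5` is `5·NZD` -/
example : NZP' 2 3 id (fun _ => 5) (7 : ℝ) 4 1 = HistoryJoinsSupTorus.NZD 2 3 id 7 4 1 * 5 := rfl

end Sanity

end

end Summit.QuantumFields.BalabanUV.T4Continuum.HistoryJoinsPlaced
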